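import Literature.Algebra.Homology.TraceCoproduct
import Literature.Algebra.Homology.EulerCharacteristicTotalComplex
import Literature.Algebra.Homology.LefschetzNumber
import HarnessLib

/-!
# The Lefschetz number of an endomorphism of a bounded double complex, from its total complex and from its columns

Layer `Literature/Algebra/Homology` (pure linear algebra over Mathlib; proved theorems only, 0 definitions, 0 named facts, no instances,
no notation). LEAF 2 of the trace companion of row `EulerCharacteristicTotalComplex` (LEAF 1 = `TraceCoproduct`). For a double complex `B`
(Mathlib `HomologicalComplex₂ (ModuleCat K) (up ℤ) (up ℤ)`, columns `B.X p`) of finite-dimensional vector spaces over a field, supported in a box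
`s ×ˢ t` of `Finset`s, and an endomorphism `φ : B ⟶ B` (so `φ^{p,q} = (φ.f p).f q`, `φ_p = φ.f p` the column endomorphisms, `Tot φ =
HomologicalComplex₂.total.map φ (up ℤ)`):

* `trace_total_map_f_eq_sum` — `tr((Tot φ)ₙ) = Σ_{(p,q) ∈ s ×ˢ t, p+q=n} tr(φ^{p,q})` (`(Tot B)ⁿ = ∐_{p+q=n} B^{p,q}` and `(Tot φ)ₙ` respects the
  summands, Mathlib `HomologicalComplex₂.ιTotal_map`; LEAF 1's `trace_sigmaObj_map_eq_sum`);
* **`lefschetzNumber_total_map_eq_sum : Λ(Tot φ) = Σ_{(p,q) ∈ s ×ˢ t} (−1)^{p+q} tr(φ^{p,q})`** — the Hopf trace formula for double complexes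
  (row `LefschetzNumber`'s `lefschetzNumber_eq_sum_χ_smul_trace_f` on `Tot B`, BY NAME; row `EulerCharacteristicTotalComplex`'s finiteness ∕ support
  lemmas BY NAME);
* **`lefschetzNumber_total_map_eq_sum_columns : Λ(Tot φ) = Σ_{p ∈ s} (−1)ᵖ Λ(φ_p)`** — the Lefschetz number of the total complex is the alternating
  sum of the Lefschetz numbers of the column endomorphisms (computed on the vertical cohomology, the `E₁` page of the column filtration; Hopf on each
  column); no spectral sequence is used.

Library only (cell `pub-hodge-ring2`, count-neutral); proves nothing about any crux, route or conjecture.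

## References

* C. A. Weibel, *An introduction to homological algebra* (1994), 1.2.6, 5.6 (total complex, double complexes). [Weibel1994]
* R. Bott, L. W. Tu, *Differential Forms in Algebraic Topology* (1982), §14 (invariants computable from any page). [BottTu1982]
* E. H. Spanier, *Algebraic Topology* (1981), Ch. 4 §7 (Lefschetz number of a chain map). [Spanier1981]
-/

open CategoryTheory CategoryTheory.Limits

universe v u

namespace Literature.Algebra.Homology.EulerCharTotal

variable {K : Type u} [Field K] (B : HomologicalComplex₂ (ModuleCat.{v} K) (ComplexShape.up ℤ) (ComplexShape.up ℤ))
  [B.HasTotal (ComplexShape.up ℤ)] [∀ p q, Module.Finite K ((B.X p).X q)] (s t : Finset ℤ)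
  (hB : ∀ p q, p ∉ s ∨ q ∉ t → Module.finrank K ((B.X p).X q) = 0) (φ : B ⟶ B)

include hB

/-- **`tr((Tot φ)ₙ) = Σ_{(p,q) ∈ s ×ˢ t, p + q = n} tr(φ^{p,q})`**: the `n`-th component of `Tot φ` respects the decomposition
`(Tot B)ⁿ = ∐_{p+q=n} B^{p,q}`. [cite: Weibel1994, 1.2.6] [cite: Spanier1981, Ch. 4 §7] -/
theorem trace_total_map_f_eq_sum (n : ℤ) :
    LinearMap.trace K _ ((HomologicalComplex₂.total.map φ (ComplexShape.up ℤ)).f n).hom =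
      ∑ i ∈ s ×ˢ t with i.1 + i.2 = n, LinearMap.trace K _ ((φ.f i.1).f i.2).hom := by
  classical
  haveI := moduleFinite_mapObjFun B n
  refine (TraceCoproduct.trace_sigmaObj_map_eq_sum
    (B.toGradedObject.mapObjFun (ComplexShape.π (ComplexShape.up ℤ) (ComplexShape.up ℤ) (ComplexShape.up ℤ)) n)
    ((s ×ˢ t).subtype fun j => j ∈ _ ⁻¹' {n})
    (fun i hi => Module.finrank_zero_iff.1 (finrank_mapObjFun_eq_zero B s t hB n i fun h => hi (Finset.mem_subtype.2 h)))
    ((HomologicalComplex₂.total.map φ (ComplexShape.up ℤ)).f n) (fun ⟨⟨p, q⟩, _⟩ => (φ.f p).f q)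
    fun ⟨⟨p, q⟩, h⟩ => HomologicalComplex₂.ιTotal_map B B φ (ComplexShape.up ℤ) p q n h).trans ?_
  refine Finset.sum_bij (fun a _ => (a : ℤ × ℤ)) (fun ⟨⟨p, q⟩, h⟩ ha => Finset.mem_filter.2 ⟨Finset.mem_subtype.1 ha, h⟩)
    (fun _ _ _ _ h => Subtype.ext h) (fun ⟨p, q⟩ hb => ?_) fun ⟨⟨p, q⟩, _⟩ _ => rfl
  exact ⟨⟨(p, q), (Finset.mem_filter.1 hb).2⟩, Finset.mem_subtype.2 (Finset.mem_filter.1 hb).1, rfl⟩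

/-- **The Hopf trace formula for a double complex: `Λ(Tot φ) = Σ_{(p,q) ∈ s ×ˢ t} (−1)^{p+q} tr(φ^{p,q})`** (row `LefschetzNumber`'s Hopf formula on
the total complex). [cite: Spanier1981, Ch. 4 §7] [cite: Weibel1994, 5.6] -/
theorem lefschetzNumber_total_map_eq_sum :
    Lefschetz.lefschetzNumber (HomologicalComplex₂.total.map φ (ComplexShape.up ℤ)) =
      ∑ i ∈ s ×ˢ t, ((i.1 + i.2).negOnePow : ℤ) • LinearMap.trace K _ ((φ.f i.1).f i.2).hom := by
  classical
  haveI := moduleFinite_total_X B s t hB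
  rw [Lefschetz.lefschetzNumber_eq_sum_χ_smul_trace_f _ _ (finrankSupport_total_subset B s t hB),
    ← Finset.sum_fiberwise_of_maps_to (s := s ×ˢ t) (t := (s ×ˢ t).image fun i => i.1 + i.2) (g := fun i => i.1 + i.2)
      (fun i hi => Finset.mem_image_of_mem _ hi)]
  refine Finset.sum_congr rfl fun n _ => ?_
  rw [trace_total_map_f_eq_sum B s t hB φ n, Finset.smul_sum]
  refine Finset.sum_congr rfl fun i hi => ?_
  rw [← (Finset.mem_filter.1 hi).2]
  rfl

/-- **`Λ(Tot φ) = Σ_{p ∈ s} (−1)ᵖ Λ(φ_p)`**: the Lefschetz number of the total complex of a bounded double complex of finite-dimensional spaces is the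
alternating sum of the Lefschetz numbers of the column endomorphisms `φ_p = φ.f p` (computed on the vertical cohomology of the columns: Hopf, row
`LefschetzNumber`, on each column). [cite: BottTu1982, §14] [cite: Spanier1981, Ch. 4 §7] -/
theorem lefschetzNumber_total_map_eq_sum_columns :
    Lefschetz.lefschetzNumber (HomologicalComplex₂.total.map φ (ComplexShape.up ℤ)) =
      ∑ p ∈ s, (p.negOnePow : ℤ) • Lefschetz.lefschetzNumber (φ.f p) := by
  rw [lefschetzNumber_total_map_eq_sum B s t hB φ, Finset.sum_product]
  refine Finset.sum_congr rfl fun p _ => ?_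
  rw [Lefschetz.lefschetzNumber_eq_sum_χ_smul_trace_f (φ.f p) t (fun q hq => by by_contra h; exact hq (hB p q (Or.inr h))),
    Finset.smul_sum]
  refine Finset.sum_congr rfl fun q _ => ?_
  rw [Int.negOnePow_add, Units.val_mul, mul_smul]
  rfl

end Literature.Algebra.Homology.EulerCharTotal
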